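import Summits.QuantumFields.BalabanUV.Beta.CombChartStepJets

/-!
# `BalabanUV.Beta.ChartStepJets` — row D1 ∕ (C1), file F6d part 1a: THE (III′)-SHAPED STEP JET DATA OVER A TABLE RECORD AT AN ARBITRARY CHART FAMILY `G`
# — `CombChartStepJets` §2–§3's packaging with the resolvent family a PARAMETER (decay + block covariance as hypotheses); the comb-chart literal
# `JsComb0Of` is its instance at `GcombSh Lc` by `rfl`

WHAT.  an2's slot families `SrecOf V H G ∕ SpureRecOf V H G ∕ WrecOf G …` (`RecursiveStencilSlot`, `RecursiveWSlot`) already take the resolvent family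
`G : ℕ → MKer` as a parameter, with letters `locStencil_SrecOf ∕ locStencil_SpureRecOf ∕ vertexFamily₂_WrecOf' ∕ SrecOf_translate ∕ SpureRecOf_translate ∕ WrecOf_translate`
taking `G`'s decay ∕ block covariance as hypotheses; only the `JetData` PACKAGING `CombChartStepJets.jsCombOf ∕ JsComb0Of` hard-wires `G := GcombSh Lc`.  This file is
that packaging with `G` free:
* §1 [our object] `SchartOf G tabs … j`, `SpureChartOf G tabs … j`, `WchartOf G tabs … j` (the families at chart `G` over the record `tabs`), unfoldings, and their letters
  (LS)(LS♭)(LW) from `hG : ∀ j, ∃ δ C, 0 < δ ∧ 0 ≤ C ∧ Decays (G j) C δ` and (St)(St♭)(Wt) from `hGt : ∀ j t, shiftK (−Lc•t) (G j) = G j` — the generic letters BY NAME;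
* §2 [our object] `jsChartOf G hG tabs … j : JetData d Lc` and **`JsChart0Of G hG tabs … : ℕ → JetData d Lc`** (packaged exactly as `jsCombOf`: constants by choice from (LS)(LW),
  common radius the `min`), `JsChart0Of_S ∕ _W` (`rfl`), (St)(Wt);
* §3 **`JsComb0Of_eq_JsChart0Of : JsComb0Of tabs … = JsChart0Of (GcombSh Lc) (decays_GcombSh Lc) tabs …`** (`rfl` — the comb-chart literal IS the instance).
WHY (SPEC S-an2-g52-1 `gen52/F6D-SPEC.v0.md` §1, RULING R-D1-g52-1 (D-b)): the raw composite jets `𝒥N m` are the (III′) literal's LEVEL-0 member AT BLOCKING `Lc^m` AT THE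
COMPOSITE CHART `A_m` (a CONSTANT family `fun _ => A_m`) over the composite record `tabsComp m` — i.e. `JsChart0Of (fun _ => A_m) … (tabsComp m) … 0`; F6d part 2 pulls it
back (`CompositeCorrectorDress.pullJ`) to `JcComp m`.  Presentation-, fork- and chart-free; [folklore] packaging BY NAME; [our object — bookkeeping] five definitions
(`SchartOf`, `SpureChartOf`, `WchartOf`, `jsChartOf`, `JsChart0Of`), no `def … : Prop`, nothing cited, 0 sorry; v1.1: the `open` block scoped INSIDE the namespace (concat-friendly).  Nothing of Bałaban's asserted, valued or discharged;
0 estimates; 0∕4 row-D1 binders (hW, hR, D1Tel, D1Rep); NOT (C1), NOT D1, NEVER «G-an2-4 closed», NOT BetaPertH, NOT continuum, NOT Clay.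

HONEST DEPENDENCY (page 1, mandatory): continuum YM on T⁴ ⇐ BetaPertH ∧ nine spine estimates (0/9 proved); BetaPertH ⇐ (D1) ∧ (D4) ∧ CAP+tail;
G-an2-4 gates asym, D1 and NE2/3/4.  Row D1 ∕ (C1) OWNER an2, gen 52, 2026-08-24.  No existing file touched.
-/

namespace Summit.QuantumFields.BalabanUV.Beta.ChartStepJets

noncomputable section

open Finset
open scoped BigOperators
open Literature.MathematicalPhysics.QuantumFieldTheory
open Literature.MathematicalPhysics.QuantumFieldTheory.Balaban1983to89
open Literature.MathematicalPhysics.QuantumFieldTheory.Balaban1983to89.Beta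
open ExpKernelCalculus (MKer Decays BiLoc VertexFamily VertexFamily₂ shiftK)
open OneStepResolventKernel (Fib LocStencil JetData)
open BalabanStepJets (locStencil_mono vertexFamily₂_mono)
open Summit.QuantumFields.BalabanUV.Beta.TameKernelCalculus
open Summit.QuantumFields.BalabanUV.Beta.AxialDressingRooted (one_le_of_neZero)
open Summit.QuantumFields.BalabanUV.Beta.WardLocusRecursive (SrecOf)
open Summit.QuantumFields.BalabanUV.Beta.SpineRooted (SpureRecOf locStencil_SrecOf locStencil_SpureRecOf SrecOf_translate SpureRecOf_translate
  WrecOf vertexFamily₂_WrecOf' WrecOf_translate)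
open Summit.QuantumFields.BalabanUV.Beta.SymmetrisedStepJets (SymTables)
open Summit.QuantumFields.BalabanUV.Beta.CombChartStepJets (GcombSh decays_GcombSh shiftK_GcombSh JsComb0Of jsCombOf ScombOf SpureCombOf WcombOf)

variable {d : ℕ}

/-! ## §1 The slot families at the record, arbitrary chart family `G` -/

section Families

variable {Lc : ℕ} [NeZero Lc] (G : ℕ → MKer (d + 1) (Fib d)) (tabs : SymTables d Lc) (cE cVH cΛ cE₂ cB : ℝ) (T : Fin 4 → Fin 4 → Fin 4 → Fin 4 → ℝ)

/-- [our object — bookkeeping] The first-order tables of the (III′)-shaped literal over `tabs` at the chart family `G`: `SrecOf V H G`. -/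
def SchartOf : ℕ → Fin (d + 1) → (Fin (d + 1) → ℤ) → MKer (d + 1) (Fib d) := SrecOf d Lc tabs.V tabs.H G cE cVH cΛ

/-- [our object — bookkeeping] Their pure (Λ-free) parts: `SpureRecOf V H G`. -/
def SpureChartOf : ℕ → Fin (d + 1) → (Fin (d + 1) → ℤ) → MKer (d + 1) (Fib d) := SpureRecOf d Lc tabs.V tabs.H G cE cVH cΛ

/-- [our object — bookkeeping] The second-order tables at the chart family `G`: `WrecOf G (SpureChartOf G …) tabs.M … tabs.vh₂S tabs.mixFF`. -/
def WchartOf : ℕ → Fin (d + 1) → (Fin (d + 1) → ℤ) → Fin (d + 1) → (Fin (d + 1) → ℤ) → MKer (d + 1) (Fib d) :=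
  WrecOf d Lc G (SpureChartOf G tabs cE cVH cΛ) tabs.M cE₂ cB T tabs.vh₂S tabs.mixFF

/-- [folklore] `SchartOf` unfolded. -/
theorem SchartOf_eq : SchartOf G tabs cE cVH cΛ = SrecOf d Lc tabs.V tabs.H G cE cVH cΛ := rfl

/-- [folklore] `SpureChartOf` unfolded. -/
theorem SpureChartOf_eq : SpureChartOf G tabs cE cVH cΛ = SpureRecOf d Lc tabs.V tabs.H G cE cVH cΛ := rfl

/-- [folklore] `WchartOf` unfolded. -/
theorem WchartOf_eq : WchartOf G tabs cE cVH cΛ cE₂ cB T =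
    WrecOf d Lc G (SpureRecOf d Lc tabs.V tabs.H G cE cVH cΛ) tabs.M cE₂ cB T tabs.vh₂S tabs.mixFF := rfl

/-- [folklore] AT THE COMB CHART the three families ARE `CombChartStepJets`' (`rfl`). -/
theorem SchartOf_GcombSh : SchartOf (GcombSh Lc) tabs cE cVH cΛ = ScombOf tabs cE cVH cΛ := rfl

/-- [folklore] (`rfl`). -/
theorem SpureChartOf_GcombSh : SpureChartOf (GcombSh Lc) tabs cE cVH cΛ = SpureCombOf tabs cE cVH cΛ := rfl

/-- [folklore] (`rfl`). -/
theorem WchartOf_GcombSh : WchartOf (GcombSh Lc) tabs cE cVH cΛ cE₂ cB T = WcombOf tabs cE cVH cΛ cE₂ cB T := rfl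

variable {G} (hG : ∀ j : ℕ, ∃ δ C : ℝ, 0 < δ ∧ 0 ≤ C ∧ Decays (G j) C δ)
  (hGt : ∀ (j : ℕ) (t : Fin (d + 1) → ℤ), shiftK (-((Lc : ℤ) • t)) (G j) = G j)

include hG in
/-- [folklore] (LS) every first-order member is a localised stencil family (an2's `locStencil_SrecOf` at the record's (LV)(LH) and `G`'s decay). -/
theorem locStencil_SchartOf : ∀ j : ℕ, ∃ Cs δ : ℝ, 0 < δ ∧ LocStencil (SchartOf G tabs cE cVH cΛ j) Cs δ :=
  locStencil_SrecOf (one_le_of_neZero Lc) tabs.hV tabs.hH hG cE cVH cΛ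

include hG in
/-- [folklore] (LS♭) every pure member is a localised stencil family. -/
theorem locStencil_SpureChartOf : ∀ j : ℕ, ∃ Cs δ : ℝ, 0 < δ ∧ LocStencil (SpureChartOf G tabs cE cVH cΛ j) Cs δ :=
  locStencil_SpureRecOf (one_le_of_neZero Lc) tabs.hV tabs.hH hG cE cVH cΛ

include hG in
/-- [folklore] (LW) every second-order member is a second-order vertex family. -/
theorem vertexFamily₂_WchartOf (j : ℕ) : ∃ Cw δw : ℝ, 0 < δw ∧ VertexFamily₂ (WchartOf G tabs cE cVH cΛ cE₂ cB T j) Lc Cw δw :=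
  vertexFamily₂_WrecOf' cE₂ cB T tabs.vh₂S tabs.mixFF (one_le_of_neZero Lc) hG (locStencil_SpureChartOf tabs cE cVH cΛ hG) tabs.hM tabs.hB tabs.hmix j

include hGt in
/-- [folklore] (St) of the first-order members (the record's (TV)(TH) and `G`'s block covariance). -/
theorem SchartOf_translate (j : ℕ) (κ' : Fin (d + 1)) (u t : Fin (d + 1) → ℤ) :
    SchartOf G tabs cE cVH cΛ j κ' (u + (Lc : ℤ) • t) = shiftK (-((Lc : ℤ) • t)) (SchartOf G tabs cE cVH cΛ j κ' u) :=
  SrecOf_translate tabs.hVt tabs.hHt hGt cE cVH cΛ j κ' u t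

include hGt in
/-- [folklore] (St♭) of the pure members. -/
theorem SpureChartOf_translate (j : ℕ) (κ' : Fin (d + 1)) (u t : Fin (d + 1) → ℤ) :
    SpureChartOf G tabs cE cVH cΛ j κ' (u + (Lc : ℤ) • t) = shiftK (-((Lc : ℤ) • t)) (SpureChartOf G tabs cE cVH cΛ j κ' u) :=
  SpureRecOf_translate tabs.hVt tabs.hHt hGt cE cVH cΛ j κ' u t

include hGt in
/-- [folklore] (Wt) of the second-order members (the record's (TM)(TB)(Tmix) and `G`'s block covariance). -/
theorem WchartOf_translate (j : ℕ) (μ : Fin (d + 1)) (y : Fin (d + 1) → ℤ) (ν : Fin (d + 1)) (y' t : Fin (d + 1) → ℤ) :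
    WchartOf G tabs cE cVH cΛ cE₂ cB T j μ (y + t) ν (y' + t) = shiftK (-((Lc : ℤ) • t)) (WchartOf G tabs cE cVH cΛ cE₂ cB T j μ y ν y') :=
  WrecOf_translate cE₂ cB T hGt (SpureChartOf_translate tabs cE cVH cΛ hGt) tabs.hMt tabs.hBt tabs.hmixt j μ y ν y' t

end Families

/-! ## §2 The packaging as jet data -/

section Package

variable {Lc : ℕ} [NeZero Lc] (G : ℕ → MKer (d + 1) (Fib d)) (hG : ∀ j : ℕ, ∃ δ C : ℝ, 0 < δ ∧ 0 ≤ C ∧ Decays (G j) C δ)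
  (tabs : SymTables d Lc) (cE cVH cΛ cE₂ cB : ℝ) (T : Fin 4 → Fin 4 → Fin 4 → Fin 4 → ℝ)

/-- [our object — bookkeeping] **THE STEP-`j` JET DATUM OF THE (III′)-SHAPED LITERAL AT THE CHART FAMILY `G`** (packaged exactly as `CombChartStepJets.jsCombOf`: constants by choice
from (LS)(LW), common radius their `min`). -/
def jsChartOf (j : ℕ) : JetData d Lc :=
  have hS := locStencil_SchartOf tabs cE cVH cΛ hG j
  have hW := vertexFamily₂_WchartOf tabs cE cVH cΛ cE₂ cB T hG j
  have hδS : 0 < hS.choose_spec.choose := hS.choose_spec.choose_spec.1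
  have hδW : 0 < hW.choose_spec.choose := hW.choose_spec.choose_spec.1
  have hloc : LocStencil (SchartOf G tabs cE cVH cΛ j) hS.choose hS.choose_spec.choose := hS.choose_spec.choose_spec.2
  have hloc₂ : VertexFamily₂ (WchartOf G tabs cE cVH cΛ cE₂ cB T j) Lc hW.choose hW.choose_spec.choose := hW.choose_spec.choose_spec.2
  { S := SchartOf G tabs cE cVH cΛ j
    W := WchartOf G tabs cE cVH cΛ cE₂ cB T j
    Cs := hS.choose
    Cw := hW.choose
    δ := min hS.choose_spec.choose hW.choose_spec.choose
    δ_pos := lt_min hδS hδW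
    loc := locStencil_mono hloc ((hloc 0 0).nonneg (Sum.inl 0)) (min_le_left _ _)
    loc₂ := vertexFamily₂_mono hloc₂ ((hloc₂ 0 0 0 0).nonneg (Sum.inl 0)) (min_le_right _ _) }

/-- [our object — bookkeeping] **THE (III′)-SHAPED FAMILY OVER ITS TABLE RECORD AT THE CHART FAMILY `G`**: `j ↦ jsChartOf G hG tabs … j`. -/
def JsChart0Of : ℕ → JetData d Lc := fun j => jsChartOf G hG tabs cE cVH cΛ cE₂ cB T j

/-- [folklore] The first-order table of member `j` (`rfl`). -/
@[simp] theorem JsChart0Of_S (j : ℕ) : (JsChart0Of G hG tabs cE cVH cΛ cE₂ cB T j).S = SchartOf G tabs cE cVH cΛ j := rfl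

/-- [folklore] The second-order table of member `j` (`rfl`). -/
@[simp] theorem JsChart0Of_W (j : ℕ) : (JsChart0Of G hG tabs cE cVH cΛ cE₂ cB T j).W = WchartOf G tabs cE cVH cΛ cE₂ cB T j := rfl

/-- [folklore] (St) for `JsChart0Of` under `G`'s block covariance. -/
theorem JsChart0Of_S_translate (hGt : ∀ (j : ℕ) (t : Fin (d + 1) → ℤ), shiftK (-((Lc : ℤ) • t)) (G j) = G j) (j : ℕ) (κ' : Fin (d + 1))
    (u t : Fin (d + 1) → ℤ) :
    (JsChart0Of G hG tabs cE cVH cΛ cE₂ cB T j).S κ' (u + (Lc : ℤ) • t) = shiftK (-((Lc : ℤ) • t)) ((JsChart0Of G hG tabs cE cVH cΛ cE₂ cB T j).S κ' u) := by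
  rw [JsChart0Of_S]
  exact SchartOf_translate tabs cE cVH cΛ hGt j κ' u t

/-- [folklore] (Wt) for `JsChart0Of` under `G`'s block covariance. -/
theorem JsChart0Of_W_translate (hGt : ∀ (j : ℕ) (t : Fin (d + 1) → ℤ), shiftK (-((Lc : ℤ) • t)) (G j) = G j) (j : ℕ) (μ : Fin (d + 1))
    (y : Fin (d + 1) → ℤ) (ν : Fin (d + 1)) (y' t : Fin (d + 1) → ℤ) :
    (JsChart0Of G hG tabs cE cVH cΛ cE₂ cB T j).W μ (y + t) ν (y' + t) = shiftK (-((Lc : ℤ) • t)) ((JsChart0Of G hG tabs cE cVH cΛ cE₂ cB T j).W μ y ν y') := by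
  rw [JsChart0Of_W]
  exact WchartOf_translate tabs cE cVH cΛ cE₂ cB T hGt j μ y ν y' t

end Package

/-! ## §3 The comb-chart literal is the instance at `GcombSh Lc` -/

section Comb

variable {Lc : ℕ} [NeZero Lc] (tabs : SymTables d Lc) (cE cVH cΛ cE₂ cB : ℝ) (T : Fin 4 → Fin 4 → Fin 4 → Fin 4 → ℝ)

/-- [folklore] **`jsCombOf = jsChartOf (GcombSh Lc) (decays_GcombSh Lc)`** (`rfl`: the same fields, the same existence proofs under the choices). -/
theorem jsCombOf_eq_jsChartOf (j : ℕ) :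
    jsCombOf tabs cE cVH cΛ cE₂ cB T j = jsChartOf (GcombSh Lc) (decays_GcombSh Lc) tabs cE cVH cΛ cE₂ cB T j := rfl

/-- [folklore] **THE COMB-CHART (III′) LITERAL IS `JsChart0Of` AT `GcombSh Lc`** (`rfl`). -/
theorem JsComb0Of_eq_JsChart0Of :
    JsComb0Of tabs cE cVH cΛ cE₂ cB T = JsChart0Of (GcombSh Lc) (decays_GcombSh Lc) tabs cE cVH cΛ cE₂ cB T := rfl

end Comb

end

end Summit.QuantumFields.BalabanUV.Beta.ChartStepJets
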